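import Literature.MathematicalPhysics.QuantumFieldTheory.Balaban1983to89.B5Prop11Lower

/-!
# T⁴ programme, spine node NE2 (U1a) — the gauge identity (1.95) «R∂*GQ* = 0» HOLDS ON EVERY FIBRE `p′ ≠ 0` of (1.83):
# `(1 − P)·∂ᴴ·G·Qᴴ = 0` for the leaf's abstract `Fiber` data

Eighth generation of the NE2 prover lineage P1 of the cell `pub-balaban`, file 17.  File 16 (`Support/BalabanHardMinimizerGauge`) typed
the ONE identity separating the kernel object `Δ_K = covB⁻¹ − a` from the printed `Δ_k` of [Balaban1984PropagatorsI] (1.65): the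
concrete (1.95).  The leaf `B5Prop11Inverse` holds Bałaban's Sect. E FIBREWISE: for each unit-lattice momentum `p′ ≠ 0` an abstract
`Fiber Λ d` (`B5Prop11Bound`) with the printed objects `dOp = ∂`, `Qp = Q′`, `Qv = Q`, `lapS`/`lapV = Δ`, `Pproj = P` of (1.70)
«P = Δ^{−1}Q′*(Q′Δ^{−2}Q′*)^{−1}Q′Δ^{−1}», `Da = Δ_a` of (1.69)/(1.73) and `F.G` = (1.83), and PROVES `Da·G = 1` (`Da_mul_G`).  THIS
FILE proves, in that language and for EVERY such fibre,

  **`R_dOpH_G_QvH_eq_zero (F : Fiber Λ d) (hΔe) : (1 − Pproj F)·(dOp F)ᴴ·F.G·(Qv F)ᴴ = 0`**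

— the fibre of the printed «so RΔ⁻¹Q′* = 0 and we have R∂*GQ* = 0, QG∂R = 0. (1.95)» (first identity), by the paper's own route
made finite-dimensional: from `Δ_a G = 1`, `Y := GQᴴ` solves `ΔY − ∂P∂ᴴY + aQᴴQY = Qᴴ`; applying the divergence `∂ᴴ` and the three
fibre identities `∂ᴴΔ = Δ∂ᴴ` (`dOpH_mul_lapV`), `∂ᴴ∂ = Δ` on scalars (`dOpH_mul_dOp`, (1.31)), `Q∂ = ∂₁Q′` (`Qv_mul_dOp`, (1.55) — the
structure field `e₁_eq`) gives `Δ(1 − P)∂ᴴY ∈ Range(Q′ᴴ)`, hence `(1 − P)∂ᴴY = Δ⁻¹Q′ᴴ(…)`; and `R = 1 − P` is idempotent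
(`Pproj_mul_Pproj`) with `RΔ⁻¹Q′ᴴ = 0` (the leaf's `R_mul_lapSinv_QpH`, from (1.70)), so `(1 − P)∂ᴴY = R·RΔ⁻¹Q′ᴴ(…) = 0`.

WHAT THIS IS AND IS NOT.  It is the `p′ ≠ 0` fibre content of file 16's typed input `Gauge195` — every fibre of the block-diagonal
momentum representation of `(1 − PcT)·GradOpᴴ·calG·QvOpᴴ` except `p′ = 0` (where `∂(0) = 0` makes the block vanish trivially) — an
independent fibrewise proof.  v1.0.1 ERRATUM: v1 called the operator-level statement a "remaining residual (R9.xii″)" — WRONG: the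
β cell's `Beta.LandauMultiplierIdentities.R_div_G_QvAdj_eq_zero` IS the operator-level concrete (1.95) (the seat had not searched
`Literature/…/Beta/`), and `Support/BalabanDeltaKIdentification.gauge195_holds` discharges `Gauge195` from it.  No transport is owed.

HONEST FRAMING (T4-DAG p. 1).  [folklore] finite-dimensional matrix algebra over the leaf's abstract fibre data (every hypothesis is a
structure field of `Fiber` or the leaf's `hΔe`); the printed (1.95) is quoted for orientation and proved here FIBREWISE (proof ours);
nothing printed is used as a hypothesis.  `U = 1`, FIXED FINITE torus, linear layer; NOT `U ≠ 1` (WALL G-an2-4), NOT infinite volume, NOT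
a mass gap, NOT Clay, NOT summit progress.  HONEST DEPENDENCY: continuum YM on T⁴ ⇐ BetaPertH ∧ nine spine estimates (0/9 proved);
BetaPertH ⇐ (D1) ∧ (D4) ∧ CAP+tail; G-an2-4 gates asym, D1 and NE2/3/4.  ABSOLUTE RULE kept; no `sorry`.
-/

noncomputable section

open scoped BigOperators ComplexConjugate Matrix
open Finset Complex

namespace Summit.QuantumFields.BalabanUV.T4Continuum.BalabanGauge195Fibre

open Literature.MathematicalPhysics.QuantumFieldTheory.Balaban1983to89.B5Prop11Bound
open Literature.MathematicalPhysics.QuantumFieldTheory.Balaban1983to89.B5Prop11Inverse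
open Literature.MathematicalPhysics.QuantumFieldTheory.Balaban1983to89.B5Prop11Lower (Pproj_mul_Pproj R_mul_lapSinv_QpH)

variable {Λ : Type*} [Fintype Λ] [DecidableEq Λ] {d : ℕ} (F : Fiber Λ d)

/-! ## §1 Three fibre identities: `∂ᴴΔ = Δ∂ᴴ`, `∂ᴴ∂ = Δ`, `Q∂ = ∂₁Q′` -/

/-- `∂ᴴ` commutes with `Δ`: `dOpᴴ·lapV = lapS·dOpᴴ` (both are multiplications by `Δ(p′ + l)`). [folklore] -/
theorem dOpH_mul_lapV : (dOp F)ᴴ * lapV F = lapS F * (dOp F)ᴴ := by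
  ext l i
  simp only [Matrix.mul_apply, Matrix.conjTranspose_apply, lapV, lapS, Matrix.diagonal_apply, dOp, mul_ite, mul_zero,
    ite_mul, zero_mul, Finset.sum_ite_eq', Finset.mem_univ, if_true]
  by_cases h : i.1 = l
  · simp [h, mul_comm]
  · simp [h]

/-- `∂ᴴ∂ = Δ` on scalars ((1.31) `Δ(p) = Σ_μ|∂_μ(p)|²`): `dOpᴴ·dOp = lapS`. [cite: Balaban1984PropagatorsI, (1.31) p.23] -/
theorem dOpH_mul_dOp (hΔe : ∀ l, F.Δ l = ∑ μ, ‖F.e μ l‖ ^ 2) : (dOp F)ᴴ * dOp F = lapS F := by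
  ext l l'
  rw [Matrix.mul_apply, Fintype.sum_prod_type, Finset.sum_eq_single l ?_ (by simp)]
  · by_cases h : l = l'
    · subst h
      simp only [Matrix.conjTranspose_apply, dOp, if_true, lapS, Matrix.diagonal_apply_eq]
      rw [Δ_cast F hΔe l]
      exact Finset.sum_congr rfl fun μ _ => by rw [Complex.star_def, mul_comm]
    · simp only [Matrix.conjTranspose_apply, dOp, if_true, if_neg h, mul_zero, Finset.sum_const_zero, lapS,
        Matrix.diagonal_apply_ne _ h]
  · intro x _ hx
    simp [Matrix.conjTranspose_apply, dOp, hx]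

/-- the unit-lattice derivative symbol as a column: `E1col μ = ∂_{1,μ}(p′)`. [folklore] -/
def E1col : Matrix (Fin d) Unit ℂ := fun μ _ => F.e₁ μ

/-- (1.55) «Q_k∂ = ∂₁Q′_k» on the fibre: `Qv·dOp = E1col·Qp` (entrywise `u v_μ ∂_μ = ∂_{1,μ} u`, the structure field `e₁_eq`).
[cite: Balaban1984PropagatorsI, (1.55) p.27] -/
theorem Qv_mul_dOp : Qv F * dOp F = E1col F * Qp F := by
  ext μ l
  rw [Matrix.mul_apply, Fintype.sum_prod_type, Finset.sum_eq_single l ?_ (by simp)]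
  · simp only [Qv, dOp, if_true, ite_mul, zero_mul, Finset.sum_ite_eq', Finset.mem_univ, Matrix.mul_apply, E1col, Qp,
      Finset.univ_unique, Finset.sum_singleton]
    rw [F.e₁_eq μ l]
    ring
  · intro x _ hx
    simp [dOp, hx]

/-- the adjoint form: `dOpᴴ·Qvᴴ = Qpᴴ·E1colᴴ`. [folklore] -/
theorem dOpH_mul_QvH : (dOp F)ᴴ * (Qv F)ᴴ = (Qp F)ᴴ * (E1col F)ᴴ := by
  rw [← Matrix.conjTranspose_mul, Qv_mul_dOp, Matrix.conjTranspose_mul]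

/-! ## §2 `Δ⁻¹Δ = 1`, `R² = R` (the leaf has `RΔ⁻¹Q′ᴴ = 0`: `B5Prop11Lower.R_mul_lapSinv_QpH`) -/

/-- `Δ⁻¹Δ = 1` on the fibre (`Δ(p′ + l) > 0` for every `l` when `p′ ≠ 0`). [folklore] -/
theorem lapSinv_mul_lapS : lapSinv F * lapS F = 1 := by
  rw [lapSinv, lapS, Matrix.diagonal_mul_diagonal, ← Matrix.diagonal_one]
  congr 1
  funext l
  have hΔ : (F.Δ l : ℂ) ≠ 0 := by exact_mod_cast (F.Δ_pos l).ne'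
  field_simp

/-- `R = 1 − P` is idempotent (`P² = P`, the leaf's `Pproj_mul_Pproj`). [folklore] -/
theorem R_mul_R : (1 - Pproj F) * (1 - Pproj F) = 1 - Pproj F := by
  rw [Matrix.sub_mul, Matrix.one_mul, Matrix.mul_sub, Matrix.mul_one, Pproj_mul_Pproj, sub_self, sub_zero]

/-! ## §3 (1.95) on the fibre -/

/-- **(1.95) ON EVERY FIBRE `p′ ≠ 0`**: «R∂*GQ* = 0» — `(1 − P)·dOpᴴ·G·Qvᴴ = 0` for the abstract (1.83) fibre data with `Δ = Σ|∂_μ|²`.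
[cite: Balaban1984PropagatorsI, (1.95) p.33 (proof ours, fibrewise)] -/
theorem R_dOpH_G_QvH_eq_zero (hΔe : ∀ l, F.Δ l = ∑ μ, ‖F.e μ l‖ ^ 2) :
    (1 - Pproj F) * (dOp F)ᴴ * F.G * (Qv F)ᴴ = 0 := by
  set Y : Matrix (Λ × Fin d) (Fin d) ℂ := F.G * (Qv F)ᴴ with hY
  set Z : Matrix Λ (Fin d) ℂ := (dOp F)ᴴ * Y with hZ
  -- (1) `Δ_a Y = Qᴴ`
  have h1 : Da F * Y = (Qv F)ᴴ := by rw [hY, ← Matrix.mul_assoc, Da_mul_G F hΔe, Matrix.one_mul]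
  -- (2) expanded: `ΔY − ∂(P(∂ᴴY)) + a•Qᴴ(QY) = Qᴴ`
  have h2 : lapV F * Y - dOp F * (Pproj F * Z) + (F.a : ℂ) • ((Qv F)ᴴ * (Qv F * Y)) = (Qv F)ᴴ := by
    have h := h1
    rw [Da] at h
    simpa only [Matrix.add_mul, Matrix.sub_mul, Matrix.smul_mul, Matrix.mul_assoc, ← hZ] using h
  -- (3) apply `∂ᴴ`: `Δ Z − Δ (P Z) + a•Q′ᴴ(E1ᴴ(QY)) = Q′ᴴ E1ᴴ`
  have h3 : lapS F * Z - lapS F * (Pproj F * Z) + (F.a : ℂ) • ((Qp F)ᴴ * ((E1col F)ᴴ * (Qv F * Y)))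
      = (Qp F)ᴴ * (E1col F)ᴴ := by
    have h := congrArg (fun X => (dOp F)ᴴ * X) h2
    simp only [Matrix.mul_add, Matrix.mul_sub, Matrix.mul_smul] at h
    rw [← Matrix.mul_assoc _ (lapV F), dOpH_mul_lapV, Matrix.mul_assoc, ← hZ, ← Matrix.mul_assoc _ (dOp F),
      dOpH_mul_dOp F hΔe, ← Matrix.mul_assoc _ (Qv F)ᴴ, dOpH_mul_QvH, Matrix.mul_assoc] at h
    exact h
  -- (4) apply `Δ⁻¹`: `(1 − P) Z = Δ⁻¹Q′ᴴ W`
  have h4 : (1 - Pproj F) * Z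
      = lapSinv F * (Qp F)ᴴ * (E1col F)ᴴ - (F.a : ℂ) • (lapSinv F * (Qp F)ᴴ * ((E1col F)ᴴ * (Qv F * Y))) := by
    have h := congrArg (fun X => lapSinv F * X) h3
    simp only [Matrix.mul_add, Matrix.mul_sub, Matrix.mul_smul, ← Matrix.mul_assoc, lapSinv_mul_lapS, Matrix.one_mul] at h
    rw [Matrix.sub_mul, Matrix.one_mul]
    rw [← h]
    simp only [Matrix.mul_assoc]
    abel
  -- (5) apply `R = 1 − P` once more
  have h5 : (1 - Pproj F) * Z = 0 := by
    rw [← R_mul_R, Matrix.mul_assoc, h4, Matrix.mul_sub, Matrix.mul_smul, ← Matrix.mul_assoc, ← Matrix.mul_assoc,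
      ← Matrix.mul_assoc ((1 - Pproj F)), Matrix.mul_assoc (1 - Pproj F) (lapSinv F), R_mul_lapSinv_QpH, Matrix.zero_mul,
      Matrix.zero_mul]
    simp
  have e : (1 - Pproj F) * (dOp F)ᴴ * F.G * (Qv F)ᴴ = (1 - Pproj F) * Z := by
    simp only [Matrix.mul_assoc, hZ, hY]
  rw [e, h5]

end Summit.QuantumFields.BalabanUV.T4Continuum.BalabanGauge195Fibre

end
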